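import Literature.MathematicalPhysics.QuantumLattice.SpinTwistedHubbardTorus

/-!
# Route `NodalDiracTwist`, crux `BridgeNodalToDWave` — uniqueness of the sector ground state

Crux stmt-HubbardSuperconductivity-10395
(`Summit.HubbardSuperconductivity.HubbardSuperconductivity.Theses.NodalDiracTwist.BridgeNodalToDWave`),
line `birth`, stub `stub_uniqueGroundStateOfPackage` (linear algebra).

What: if the spin-twisted Hubbard torus at the untwisted point,
`H_L(U, 0) = spinTwistedHubbardTorus L U 0` with `L ≥ 3`, admits no two orthogonal ground states in
the joint sector `(N, S^z = 0)`, then the `(N, 0)`-sector ground state of the Statement's Hamiltonian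
`hubbardTorus 2 L 1 U` is unique up to scalars. The nodal-Dirac package of the crux supplies the
hypothesis at `φ = 0` (the degeneracy locus `(±c, ±c)`, `c > 0`, misses the origin).

Proof: `H_L(U, 0) = hubbardTorus 2 L 1 U` (`spinTwistedHubbardTorus_zero`, needs `3 ≤ L`), then
Gram–Schmidt inside the sector eigenspace: for two sector ground states `χ₁, χ₂` (eigenvectors for the
same lowest sector energy `minEnergyOn`) the vector `η = χ₂ - (⟨χ₁, χ₂⟩ / ⟨χ₁, χ₁⟩) χ₁` lies in the
sector, is an eigenvector for the same energy and is orthogonal to `χ₁`; were it nonzero, `(χ₁, η)`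
would be an orthogonal pair of sector ground states, so `η = 0`.

Sources: E. H. Lieb, Phys. Rev. Lett. 62 (1989) 1201 (the joint `(N, S^z)` sectors); elementary
linear algebra (Mathlib `dotProduct_star_self_eq_zero`). No new definitions.
-/

-- the mandated namespace repeats `HubbardSuperconductivity` (single-problem summit, D-0017)
set_option linter.dupNamespace false

namespace Summit.HubbardSuperconductivity.HubbardSuperconductivity.Theorems.NodalDiracTwist.BridgeNodalToDWave

open Literature.MathematicalPhysics.QuantumLattice Matrix
open scoped ComplexOrder

/-- **Unique sector ground state from the package at `φ = 0`.** If `H_L(U, 0)` (`L ≥ 3`) has no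
two orthogonal ground states in the sector `(N, S^z = 0)`, then any two `(N, 0)`-sector ground
states `χ₁, χ₂` of `hubbardTorus 2 L 1 U` are proportional: `χ₂ = z • χ₁` with
`z = ⟨χ₁, χ₂⟩ / ⟨χ₁, χ₁⟩` (Gram–Schmidt in the sector eigenspace, after
`spinTwistedHubbardTorus_zero`). Lieb, PRL 62 (1989) 1201 (sectors). [folklore] -/
theorem stub_uniqueGroundStateOfPackage : ∀ (L : ℕ) [NeZero L], 3 ≤ L → ∀ (U : ℝ) (N : ℕ),
    (¬ ∃ ψ₁ ψ₂ : Literature.MathematicalPhysics.QuantumLattice.Fock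
        (Literature.MathematicalPhysics.QuantumLattice.Orb
          (Literature.MathematicalPhysics.QuantumLattice.FermionTorus 2 L)),
        Literature.MathematicalPhysics.QuantumLattice.IsGroundStateInSector
          (Literature.MathematicalPhysics.QuantumLattice.spinTwistedHubbardTorus L U 0) N 0 ψ₁ ∧
        Literature.MathematicalPhysics.QuantumLattice.IsGroundStateInSector
          (Literature.MathematicalPhysics.QuantumLattice.spinTwistedHubbardTorus L U 0) N 0 ψ₂ ∧
        star ψ₁ ⬝ᵥ ψ₂ = 0) →
    ∀ χ₁ χ₂ : Literature.MathematicalPhysics.QuantumLattice.Fock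
        (Literature.MathematicalPhysics.QuantumLattice.Orb
          (Literature.MathematicalPhysics.QuantumLattice.FermionTorus 2 L)),
      Literature.MathematicalPhysics.QuantumLattice.IsGroundStateInSector
        (Literature.MathematicalPhysics.QuantumLattice.hubbardTorus 2 L 1 U) N 0 χ₁ →
      Literature.MathematicalPhysics.QuantumLattice.IsGroundStateInSector
        (Literature.MathematicalPhysics.QuantumLattice.hubbardTorus 2 L 1 U) N 0 χ₂ →
      ∃ z : ℂ, χ₂ = z • χ₁ := by
  intro L _ hL U N hno χ₁ χ₂ h₁ h₂
  rw [spinTwistedHubbardTorus_zero L hL U] at hno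
  obtain ⟨hmem₁, hne₁, heig₁⟩ := h₁
  obtain ⟨hmem₂, -, heig₂⟩ := h₂
  -- `⟨χ₁, χ₁⟩ ≠ 0` since `χ₁ ≠ 0`
  have h11 : star χ₁ ⬝ᵥ χ₁ ≠ 0 := fun h => hne₁ (dotProduct_star_self_eq_zero.1 h)
  refine ⟨star χ₁ ⬝ᵥ χ₂ / star χ₁ ⬝ᵥ χ₁, ?_⟩
  -- the Gram–Schmidt remainder `η = χ₂ - z • χ₁` is in the sector ...
  have hηmem : χ₂ - (star χ₁ ⬝ᵥ χ₂ / star χ₁ ⬝ᵥ χ₁) • χ₁ ∈ szSector N 0 :=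
    Submodule.sub_mem _ hmem₂ (Submodule.smul_mem _ _ hmem₁)
  -- ... is an eigenvector for the lowest sector energy ...
  have hηeig : hubbardTorus 2 L 1 U *ᵥ (χ₂ - (star χ₁ ⬝ᵥ χ₂ / star χ₁ ⬝ᵥ χ₁) • χ₁) =
      (((hubbardTorus 2 L 1 U).minEnergyOn (szSector N 0) : ℝ) : ℂ) •
        (χ₂ - (star χ₁ ⬝ᵥ χ₂ / star χ₁ ⬝ᵥ χ₁) • χ₁) := by
    rw [Matrix.mulVec_sub, Matrix.mulVec_smul, heig₁, heig₂, smul_sub,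
      smul_comm (star χ₁ ⬝ᵥ χ₂ / star χ₁ ⬝ᵥ χ₁)]
  -- ... and is orthogonal to `χ₁`
  have hηorth : star χ₁ ⬝ᵥ (χ₂ - (star χ₁ ⬝ᵥ χ₂ / star χ₁ ⬝ᵥ χ₁) • χ₁) = 0 := by
    rw [dotProduct_sub, dotProduct_smul, smul_eq_mul, div_mul_cancel₀ _ h11, sub_self]
  -- hence it vanishes: otherwise `(χ₁, η)` is an orthogonal pair of sector ground states
  by_contra hne
  exact hno ⟨χ₁, _, ⟨hmem₁, hne₁, heig₁⟩, ⟨hηmem, fun h => hne (sub_eq_zero.1 h), hηeig⟩, hηorth⟩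

end Summit.HubbardSuperconductivity.HubbardSuperconductivity.Theorems.NodalDiracTwist.BridgeNodalToDWave
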